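import Summits.AtomisticToContinuum.BoseEinsteinCondensation.Theorems.InfraredMinimumUncertainty.Negative.CoherenceBounds
import Summits.AtomisticToContinuum.BoseEinsteinCondensation.Theorems.GaussianDominationCan.Negative.ProductStatesConst

/-!
# Negative lemmas for crux `InfraredMinimumUncertainty` (stmt-AtomisticToContinuum-11784) — VI:
# the minimisers of the FREE gas are the constants, so the crux holds at `v ≡ 0` with `C = 0`

Supports (does not close) stmt-AtomisticToContinuum-11784 (route `BECConjugateDomination`).
Importable form of §E of the cdisprove seat's standing file
`Cruxes/InfraredMinimumUncertainty/Disproof.lean`.  The POSITIVE CONTROL of the load-bearing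
analysis: the degenerate member `v ≡ 0` of the smooth class is not a counterexample, and not only
for the constant state — EVERY minimiser of the free periodic energy is constant.

* `boxN_isOpen`, `boxN_convex`, `boxN_sub_cellN`, `cellN_subset_closure_boxN` (the half-open
  cell lies in the closure of the open box: segment to the centre);
* `kineticDensity_continuous`, `fderiv_eq_zero_of_kineticDensity_eq_zero` (the partial derivatives
  along `e_{i,k}` span `(ℝ³)^N`);
* `exists_eq_const_of_kinetic_zero`: **`∫_{cell^N} |∇Ψ|² = 0 ⟹ Ψ ≡ c`**
  (a.e. zero + continuity on the open box `eqOn_open_of_ae_eq`; `fderiv = 0` on an open convex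
  set `IsOpen.is_const_of_fderiv_eq_zero`; closure; then the lattice `(Lℤ³)^N` via
  `periodic_zspan` / `ZSpan.fract` and `fundamentalDomain_latticeBasisN`);
* `periodicGroundStateEnergy_free` (`E₀^{per}(v ≡ 0) = 0`),
  `exists_eq_const_of_free_minimiser`;
* `coherence_const` (`g ≡ 1`), `levyWeight_const` (`ν ≡ 0`), and **`pi_eq_zero_of_free_minimiser`**:
  for `v ≡ 0` every minimiser has `N·ν_m·S_m = 0` for every `m` — the crux's conclusion with
  `C = 0`, at every `ρ` and every `N` (no positivity needed).
-/

noncomputable section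

open MeasureTheory Filter Set
open scoped ENNReal NNReal Topology ComplexConjugate BigOperators

namespace Summit.AtomisticToContinuum.BoseEinsteinCondensation.Theorems.InfraredMinimumUncertainty.Negative

open Literature.MathematicalPhysics.QuantumManyBody.BoseGas
open Summit.AtomisticToContinuum.BoseEinsteinCondensation.Theses.BECConjugateDomination
open Summit.AtomisticToContinuum.BoseEinsteinCondensation.Cruxes.InfraredMinimumUncertainty.FisherGaussianDensityMode
open Summit.AtomisticToContinuum.BoseEinsteinCondensation.Theorems.GaussianDominationCan.Negative
  (constState periodicEnergy_constState periodicInteraction_zero)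

section FreeMinimisers

variable {N : ℕ} {L : ℝ}

/-! ### The open box inside the half-open cell -/

/-- The open `N`-particle box `(0,L)^{3N}` is open. [folklore] -/
theorem boxN_isOpen (N : ℕ) (L : ℝ) : IsOpen (boxN N L) := by
  have : boxN N L = ⋂ i : Fin N, ⋂ k : Fin 3, (fun X : Config N => X i k) ⁻¹' Set.Ioo 0 L := by
    ext X; simp [boxN, box]
  rw [this]
  exact isOpen_iInter_of_finite fun i => isOpen_iInter_of_finite fun k =>
    isOpen_Ioo.preimage (by fun_prop)

/-- The open box is convex. [folklore] -/
theorem boxN_convex (N : ℕ) (L : ℝ) : Convex ℝ (boxN N L) := by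
  intro X hX Y hY a b ha hb hab i k
  have h1 := hX i k
  have h2 := hY i k
  simp only [Pi.add_apply, Pi.smul_apply, PiLp.add_apply, PiLp.smul_apply, smul_eq_mul,
    Set.mem_Ioo] at h1 h2 ⊢
  have hlo := lt_min h1.1 h2.1
  have hhi := max_lt h1.2 h2.2
  constructor
  · nlinarith [mul_nonneg ha (sub_nonneg.2 (min_le_left ((X i).ofLp k) ((Y i).ofLp k))),
      mul_nonneg hb (sub_nonneg.2 (min_le_right ((X i).ofLp k) ((Y i).ofLp k)))]
  · nlinarith [mul_nonneg ha (sub_nonneg.2 (le_max_left ((X i).ofLp k) ((Y i).ofLp k))),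
      mul_nonneg hb (sub_nonneg.2 (le_max_right ((X i).ofLp k) ((Y i).ofLp k)))]

/-- The open box lies in the cell. [folklore] -/
theorem boxN_sub_cellN (N : ℕ) (L : ℝ) : boxN N L ⊆ cellN N L :=
  fun _ hX i k => ⟨(hX i k).1.le, (hX i k).2⟩

/-- The centre of the box. -/
def boxCentre (N : ℕ) (L : ℝ) : Config N := fun _ => WithLp.toLp 2 fun _ : Fin 3 => L / 2

/-- The centre lies in the open box. [folklore] -/
theorem boxCentre_mem (hL : 0 < L) : boxCentre N L ∈ boxN N L := by
  intro i k
  simp only [boxCentre, Set.mem_Ioo]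
  constructor <;> linarith

/-- **The cell lies in the closure of the open box**: every `X ∈ [0,L)^{3N}` is the limit of the
points `X + t(M − X)`, `t → 0⁺`, of the segment to the centre `M`, which lie in `(0,L)^{3N}`. [folklore] -/
theorem cellN_subset_closure_boxN (hL : 0 < L) : cellN N L ⊆ closure (boxN N L) := by
  intro X hX
  set γ : ℝ → Config N := fun t => X + t • (boxCentre N L - X) with hγ
  have hγc : Continuous γ := by rw [hγ]; fun_prop
  have hmem : ∀ t : ℝ, t ∈ Set.Ioo (0 : ℝ) 1 → γ t ∈ boxN N L := by
    intro t ht i k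
    have h1 := hX i k
    simp only [hγ, Pi.add_apply, Pi.smul_apply, Pi.sub_apply, PiLp.add_apply, PiLp.smul_apply,
      PiLp.sub_apply, smul_eq_mul, boxCentre, Set.mem_Ioo, Set.mem_Ico] at h1 ⊢
    constructor <;> nlinarith [h1.1, h1.2, ht.1, ht.2]
  have hlim : Tendsto γ (𝓝[>] 0) (𝓝 X) := by
    have h0 : γ 0 = X := by simp [hγ]
    rw [← h0]
    exact (hγc.tendsto 0).mono_left nhdsWithin_le_nhds
  refine mem_closure_of_tendsto hlim ?_
  filter_upwards [Ioo_mem_nhdsGT (zero_lt_one' ℝ)] with t ht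
  exact hmem t ht

/-! ### Zero kinetic density forces a constant -/

/-- The kinetic density of a `C¹` function is continuous (as an `ℝ≥0∞`-valued function). [folklore] -/
theorem kineticDensity_continuous {ψ : Config N → ℂ} (hψ : ContDiff ℝ 1 ψ) :
    Continuous (kineticDensity ψ) := by
  unfold kineticDensity
  have hf : Continuous (fderiv ℝ ψ) := hψ.continuous_fderiv one_ne_zero
  refine continuous_finsetSum _ fun i _ => continuous_finsetSum _ fun k _ => ?_
  have h1 : Continuous fun X => fderiv ℝ ψ X (Pi.single i (EuclideanSpace.single k (1 : ℝ))) :=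
    hf.clm_apply continuous_const
  exact (ENNReal.continuous_pow 2).comp (ENNReal.continuous_coe.comp h1.nnnorm)

/-- If the kinetic density vanishes at `X` then `dψ(X) = 0` (the directions `e_{i,k}` span
`(ℝ³)^N`). [folklore] -/
theorem fderiv_eq_zero_of_kineticDensity_eq_zero {ψ : Config N → ℂ} {X : Config N}
    (h : kineticDensity ψ X = 0) : fderiv ℝ ψ X = 0 := by
  classical
  unfold kineticDensity at h
  have hik : ∀ (i : Fin N) (k : Fin 3),
      fderiv ℝ ψ X (Pi.single i (EuclideanSpace.single k (1 : ℝ))) = 0 := by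
    intro i k
    have h1 := (Finset.sum_eq_zero_iff.mp h) i (Finset.mem_univ _)
    have h2 := (Finset.sum_eq_zero_iff.mp h1) k (Finset.mem_univ _)
    rw [pow_eq_zero_iff two_ne_zero, ENNReal.coe_eq_zero, nnnorm_eq_zero] at h2
    exact h2
  -- a continuous linear map vanishing on a basis vanishes
  set b : Module.Basis (Σ _ : Fin N, Fin 3) ℝ (Config N) :=
    Pi.basis fun _ : Fin N => (EuclideanSpace.basisFun (Fin 3) ℝ).toBasis with hb
  have hlin : (fderiv ℝ ψ X).toLinearMap = (0 : Config N →L[ℝ] ℂ).toLinearMap := by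
    refine b.ext fun ik => ?_
    obtain ⟨i, k⟩ := ik
    rw [hb, Pi.basis_apply]
    simpa [OrthonormalBasis.coe_toBasis, EuclideanSpace.basisFun_apply] using hik i k
  exact ContinuousLinearMap.coe_injective hlin

/-- **Zero kinetic energy forces a constant.**  If an admissible periodic state has
`∫_{cell^N} |∇Ψ|² = 0` then `Ψ ≡ c` on all of `(ℝ³)^N`. [folklore] -/
theorem exists_eq_const_of_kinetic_zero (hL : 0 < L) (Ψ : PeriodicTrialState N L)
    (h0 : ∫⁻ X in cellN N L, kineticDensity Ψ.ψ X = 0) : ∃ c : ℂ, ∀ X, Ψ.ψ X = c := by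
  have hK := kineticDensity_continuous Ψ.contDiff
  -- a.e. zero on the cell, hence on the open box, hence everywhere on the open box
  have hae : kineticDensity Ψ.ψ =ᵐ[volume.restrict (cellN N L)] 0 :=
    (lintegral_eq_zero_iff hK.measurable).mp h0
  have hae' : kineticDensity Ψ.ψ =ᵐ[volume.restrict (boxN N L)] 0 :=
    ae_restrict_of_ae_restrict_of_subset (boxN_sub_cellN N L) hae
  have hbox : EqOn (kineticDensity Ψ.ψ) 0 (boxN N L) :=
    Measure.eqOn_open_of_ae_eq hae' (boxN_isOpen N L) hK.continuousOn continuousOn_const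
  -- `dΨ = 0` on the open convex box, so `Ψ` is constant there
  have hd : ∀ X ∈ boxN N L, fderiv ℝ Ψ.ψ X = 0 := fun X hX =>
    fderiv_eq_zero_of_kineticDensity_eq_zero (hbox hX)
  set c : ℂ := Ψ.ψ (boxCentre N L) with hc
  have hconst : EqOn Ψ.ψ (fun _ => c) (boxN N L) := fun X hX =>
    (boxN_isOpen N L).is_const_of_fderiv_eq_zero (boxN_convex N L).isPreconnected
      ((Ψ.contDiff.differentiable one_ne_zero).differentiableOn) hd hX (boxCentre_mem hL)
  -- by continuity on the closure, which contains the cell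
  have hcell : EqOn Ψ.ψ (fun _ => c) (cellN N L) := fun X hX =>
    (hconst.closure Ψ.contDiff.continuous continuous_const) (cellN_subset_closure_boxN hL hX)
  -- by periodicity everywhere: reduce `X` to the cell along the lattice `(Lℤ³)^N`
  refine ⟨c, fun X => ?_⟩
  set b : Module.Basis (Σ _ : Fin N, Fin 3) ℝ (Config N) :=
    (Pi.basis fun _ : Fin N =>
      (EuclideanSpace.basisFun (Fin 3) ℝ).toBasis.unitsSMul fun _ : Fin 3 => Units.mk0 _ (ne_of_gt hL))
    with hbdef
  set G : Config N → ℝ≥0∞ := fun Z => (‖Ψ.ψ Z - c‖₊ : ℝ≥0∞) with hGdef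
  have hG : ∀ (Y : Config N) (i : Fin N) (k : Fin 3),
      G (Y + Pi.single i (EuclideanSpace.single k L)) = G Y := fun Y i k => by
    simp only [hGdef, Ψ.periodic]
  have hfract : ZSpan.fract b X ∈ cellN N L := by
    rw [← fundamentalDomain_latticeBasisN hL]
    exact ZSpan.fract_mem_fundamentalDomain b X
  have hper := periodic_zspan hL hG ⟨(ZSpan.floor b X : Config N), (ZSpan.floor b X).2⟩
    (ZSpan.fract b X)
  have hX : ((⟨(ZSpan.floor b X : Config N), (ZSpan.floor b X).2⟩ :
      (Submodule.span ℤ (Set.range b)).toAddSubgroup) +ᵥ ZSpan.fract b X) = X := by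
    rw [AddSubgroup.vadd_def, vadd_eq_add, ZSpan.fract_apply]
    simp
  rw [hX] at hper
  have h0' : G (ZSpan.fract b X) = 0 := by
    rw [hGdef]
    simp only
    rw [hcell hfract, sub_self, nnnorm_zero, ENNReal.coe_zero]
  have : G X = 0 := by rw [hper]; exact h0'
  rw [hGdef] at this
  simp only at this
  rw [ENNReal.coe_eq_zero, nnnorm_eq_zero, sub_eq_zero] at this
  exact this

/-! ### The free periodic problem: `E₀ = 0` and the minimisers -/

/-- **`E₀^{per} = 0` for the free gas** (the normalised constant state has zero energy). [folklore] -/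
theorem periodicGroundStateEnergy_free (hL : 0 < L) (n : ℕ) :
    periodicGroundStateEnergy 0 (n + 1) L = 0 := by
  have hL3 : 0 < L ^ 3 := by positivity
  have hc : ((Real.sqrt (L ^ 3))⁻¹) ^ 2 * L ^ 3 = 1 := by
    rw [inv_pow, Real.sq_sqrt hL3.le, inv_mul_cancel₀ hL3.ne']
  refine le_antisymm ?_ bot_le
  calc periodicGroundStateEnergy 0 (n + 1) L ≤ periodicEnergy 0 (constState n hL _ hc) :=
        periodicGroundStateEnergy_le 0 _
    _ = 0 := periodicEnergy_constState hL hc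

/-- **The minimisers of the free periodic energy are the constants.** [folklore] -/
theorem exists_eq_const_of_free_minimiser (hL : 0 < L) {n : ℕ}
    (Ψ : PeriodicTrialState (n + 1) L)
    (hE : periodicEnergy 0 Ψ = periodicGroundStateEnergy 0 (n + 1) L) :
    ∃ c : ℂ, ∀ X, Ψ.ψ X = c := by
  refine exists_eq_const_of_kinetic_zero hL Ψ ?_
  rw [periodicGroundStateEnergy_free hL n] at hE
  unfold periodicEnergy at hE
  simpa only [periodicInteraction_zero, zero_mul, add_zero] using hE

/-! ### The crux's objects on a constant state -/

/-- For a constant state the coherence is `g ≡ 1`. [folklore] -/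
theorem coherence_const (hL : 0 < L) {n : ℕ} (Ψ : PeriodicTrialState (n + 1) L) {c : ℂ}
    (hc : ∀ X, Ψ.ψ X = c) (r : Space) : coherence n L Ψ r = 1 := by
  rw [← coherence_zero hL Ψ]
  unfold coherence
  simp only [hc]

/-- For a constant state every Lévy weight vanishes: `ν ≡ 0` (`log g = log 1 = 0`). [folklore] -/
theorem levyWeight_const (hL : 0 < L) {n : ℕ} (Ψ : PeriodicTrialState (n + 1) L) {c : ℂ}
    (hc : ∀ X, Ψ.ψ X = c) (m : Fin 3 → ℤ) : levyWeight n L Ψ m = 0 := by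
  unfold levyWeight
  simp only [coherence_const hL Ψ hc, Real.log_one, Complex.ofReal_zero]
  rw [cellFourierCoeff_eq_integral hL]
  simp

/-- **The crux's conclusion holds at `v ≡ 0` with `C = 0`, for EVERY minimiser** (at every side
`L > 0`, every `N = n+1`, every mode; no positivity needed): `N · ν_m · S_m = 0`. [folklore] -/
theorem pi_eq_zero_of_free_minimiser (hL : 0 < L) {n : ℕ} (Ψ : PeriodicTrialState (n + 1) L)
    (hE : periodicEnergy 0 Ψ = periodicGroundStateEnergy 0 (n + 1) L) (m : Fin 3 → ℤ) :
    ((n : ℝ) + 1) * levyWeight n L Ψ m * structureFactor n L Ψ m = 0 := by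
  obtain ⟨c, hc⟩ := exists_eq_const_of_free_minimiser hL Ψ hE
  rw [levyWeight_const hL Ψ hc, mul_zero, zero_mul]

end FreeMinimisers

end Summit.AtomisticToContinuum.BoseEinsteinCondensation.Theorems.InfraredMinimumUncertainty.Negative

end
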